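import Mathlib

/-!
# PneNP / OverlapGapAlgebra — crux `SolvableImpliesStableSection` (stmt-PneNP-2463):
# the TWO-WAY REPAIR block (12/·) — the two-way repair values exist

Support for crux `stmt-PneNP-2463` (`Summit.PneNP.PneNP.Theses.OverlapGapAlgebra.SolvableImpliesStableSection`):
the f-free block "bounded-round two-way repair with one-round memory gives stable sections for every
`ν > 0` up to `α ≤ 2^k/(4k)`".  The blocks are written against HYPOTHESES specifying their objects;
this file constructs the one new object, the values `val : ℕ → instances → Fin n → Bool` of the
two-way repair with one-round memory (all `true` at round `0`; `val (t+1) Φ v = val t Φ v` iff `v` is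
not the nominee of a clause violated at round `t`, the nominee being the least slot in the priority
order that reads `val t` and `val (t-1)`), by primitive recursion on the PAIR (current values, previous
values).  (The assembling operation and the code families are those of `…MonotoneRepairObjects`.)

* `sissW_exists_val` — the two-way repair values exist.
No definitions of constants; axioms `propext`, `Classical.choice`, `Quot.sound`.
-/

set_option linter.dupNamespace false -- `Summit.PneNP.PneNP.…`: summit = sub-problem (D-0017)

namespace Summit.PneNP.PneNP.Theorems

open Finset
open scoped Classical

section Objects

variable {m k n : ℕ}

/-- **The two-way repair values exist**: a `val : ℕ → instances → Fin n → Bool` with all variables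
`true` at round `0` and the two-way step with one-round memory. -/
theorem sissW_exists_val :
    ∃ val : ℕ → (Fin m → Fin k → Fin n × Bool) → Fin n → Bool, (∀ (Φ : (Fin m → Fin k → Fin n × Bool)) (v : Fin n), val 0 Φ v = true) ∧ (∀ (t : ℕ) (Φ : (Fin m → Fin k → Fin n × Bool)) (v : Fin n), val (t + 1) Φ v = val t Φ v ↔
      ¬ (∃ ii : Fin m, (∀ jj : Fin k, val t Φ (Φ ii jj).1 ≠ (Φ ii jj).2) ∧
        ∃ jf : Fin k, (∀ j' : Fin k, (if 1 ≤ t ∧ val t Φ (Φ ii jf).1 ≠ val (t - 1) Φ (Φ ii jf).1 then (2 : ℕ)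
          else if (Φ ii jf).2 = true then 1 else 0) < (if 1 ≤ t ∧ val t Φ (Φ ii j').1 ≠ val (t - 1) Φ (Φ ii j').1 then (2 : ℕ)
          else if (Φ ii j').2 = true then 1 else 0) ∨
        ((if 1 ≤ t ∧ val t Φ (Φ ii jf).1 ≠ val (t - 1) Φ (Φ ii jf).1 then (2 : ℕ)
          else if (Φ ii jf).2 = true then 1 else 0) = (if 1 ≤ t ∧ val t Φ (Φ ii j').1 ≠ val (t - 1) Φ (Φ ii j').1 then (2 : ℕ)
          else if (Φ ii j').2 = true then 1 else 0) ∧ jf ≤ j')) ∧ (Φ ii jf).1 = v)) := by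
  -- the pair (values at round `t`, values at round `t - 1`)
  let P : ℕ → ((Fin m → Fin k → Fin n × Bool) → Fin n → Bool) × ((Fin m → Fin k → Fin n × Bool) → Fin n → Bool) := fun t =>
    Nat.rec (motive := fun _ => ((Fin m → Fin k → Fin n × Bool) → Fin n → Bool) × ((Fin m → Fin k → Fin n × Bool) → Fin n → Bool))
      (fun _ _ => true, fun _ _ => true)
      (fun t pr => (fun Φ v => if (∃ ii : Fin m, (∀ jj : Fin k, pr.1 Φ (Φ ii jj).1 ≠ (Φ ii jj).2) ∧
        ∃ jf : Fin k, (∀ j' : Fin k, (if 1 ≤ t ∧ pr.1 Φ (Φ ii jf).1 ≠ pr.2 Φ (Φ ii jf).1 then (2 : ℕ)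
          else if (Φ ii jf).2 = true then 1 else 0) < (if 1 ≤ t ∧ pr.1 Φ (Φ ii j').1 ≠ pr.2 Φ (Φ ii j').1 then (2 : ℕ)
          else if (Φ ii j').2 = true then 1 else 0) ∨
        ((if 1 ≤ t ∧ pr.1 Φ (Φ ii jf).1 ≠ pr.2 Φ (Φ ii jf).1 then (2 : ℕ)
          else if (Φ ii jf).2 = true then 1 else 0) = (if 1 ≤ t ∧ pr.1 Φ (Φ ii j').1 ≠ pr.2 Φ (Φ ii j').1 then (2 : ℕ)
          else if (Φ ii j').2 = true then 1 else 0) ∧ jf ≤ j')) ∧ (Φ ii jf).1 = v) then !(pr.1 Φ v) else pr.1 Φ v, pr.1)) t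
  refine ⟨fun t => (P t).1, fun _ _ => rfl, fun t Φ v => ?_⟩
  have hprev : (P t).2 = (P (t - 1)).1 := by
    cases t with
    | zero => rfl
    | succ t => rfl
  have hstep : (P (t + 1)).1 Φ v =
      (if (∃ ii : Fin m, (∀ jj : Fin k, (P t).1 Φ (Φ ii jj).1 ≠ (Φ ii jj).2) ∧
        ∃ jf : Fin k, (∀ j' : Fin k, (if 1 ≤ t ∧ (P t).1 Φ (Φ ii jf).1 ≠ (P t).2 Φ (Φ ii jf).1 then (2 : ℕ)
          else if (Φ ii jf).2 = true then 1 else 0) < (if 1 ≤ t ∧ (P t).1 Φ (Φ ii j').1 ≠ (P t).2 Φ (Φ ii j').1 then (2 : ℕ)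
          else if (Φ ii j').2 = true then 1 else 0) ∨
        ((if 1 ≤ t ∧ (P t).1 Φ (Φ ii jf).1 ≠ (P t).2 Φ (Φ ii jf).1 then (2 : ℕ)
          else if (Φ ii jf).2 = true then 1 else 0) = (if 1 ≤ t ∧ (P t).1 Φ (Φ ii j').1 ≠ (P t).2 Φ (Φ ii j').1 then (2 : ℕ)
          else if (Φ ii j').2 = true then 1 else 0) ∧ jf ≤ j')) ∧ (Φ ii jf).1 = v) then !((P t).1 Φ v) else (P t).1 Φ v) := rfl
  dsimp only
  rw [hstep, hprev]
  generalize (P t).1 Φ v = a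
  split_ifs with hC
  · constructor
    · intro h; cases a <;> simp at h
    · intro h; exact absurd hC h
  · exact ⟨fun _ => hC, fun _ => rfl⟩

end Objects

end Summit.PneNP.PneNP.Theorems
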